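/-
Copyright (c) 2026 the pub-hodgecm-mathlib formalisation cell (harness21).  Prover seat hodgecm-mathlib-LH4-p14 (g0), req620 Track A «(D-RAM) FOUR-FRAME» squad
(heir LEAD F0P3a-plan (g19) (R-17) «NI2 ⊕ MS»; dealer LH4-plan (g10) WORD #38 (2); MS ROAD-A brick of LH4-p10 (g0) 22:32:55Z, first seat of (MS)).  2026-09-03.
-/
import Literature.NumberTheory.Automorphic.UnitaryLatticeTreeDual   -- ★ `mulVec_single_mem_latt`; brings ★ `UnitaryLatticeTreeDefs` (`latt`), ★ `mem_stdLattice`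
import HarnessLib

/-!
# Crux `H413`, line LH4 «(D-RAM) FOUR-FRAME» road — unit U3_Laws (iii), (R-17) MS ROAD A, TIER 2 SUPPORT: «ROW IDEAL OF A COLUMN LATTICE» — the `i`-th coordinate ideal of
# `latt g = g·𝒪^N` is generated by the `i`-th ROW of `g`: `sup_{w ∈ latt g} |w_i| = max_j |g_{ij}|`

Cell `hodgecm-mathlib` (D-0151), FLOOR 0, crux item H413 = `stmt-HodgeConjecture-24833`, route of record `HCCMUnconditional`; squad F0∕P3c∕LH4 (req618∕req620).  THEOREMS ONLY
(no `def`, no instance, no notation, no `sorry`, default heartbeats); lane `--supports stmt-HodgeConjecture-24833 --as helper` (count-neutral).  MS ROAD-A brick of LH4-p10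
(g0)'s (S-fin) reduction (MEMO `F0/P3c/LH4/LH4-p10/g0/MEMO-stableLaw-finite.v1.LH4p10g0.md` §3), statement BY SIGNATURE as worded on the squad bus 2026-09-03T22:32:55Z; it feeds
both the normalisation clause `pr_i(latt V) = 𝒪` and the dualisability exponents `pr_i((latt V)^♯) = 𝔭^{m_i}` read off the rows of the dual frame ★ p855301 `dualLatt_diagonal_latt_hnf`.

WHAT IS PROVED (generic valued field, any `N`; heads at `N = 3` verbatim).  For a matrix `g` and a slot `i`: every `w ∈ latt g = g·𝒪^N` has `|w_i| ≤ max_j |g_{ij}|` (ultrametric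
inequality on `w_i = Σ_j g_{ij} u_j`, `|u_j| ≤ 1`), and the bound is attained at the column `g·e_{j₀}` of an argmax `j₀` (★ `mulVec_single_mem_latt`).
* `v_apply_le_sup_of_mem_latt'`, `exists_mem_latt_v_apply_eq_sup'` — generic `N` (with `[NeZero N]` for the non-empty index set).
* **`v_apply_le_sup_of_mem_latt`**, **`exists_mem_latt_v_apply_eq_sup`** — the `Fin 3` heads verbatim.
HONEST LABEL.  Count-neutral; nothing printed is asserted; the census laws stay PROVER TARGETS; `HC_CM` is proved only modulo the 7 printed citations (2 remaining named inputs: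
hLiu418 = `stmt-HodgeConjecture-24832`, h413 = `stmt-HodgeConjecture-24833`) until rung 0 closes.

## References
* [Serre1980Trees] J.-P. Serre, *Trees*, Springer (1980), Ch. II §1.1 (lattices `g·𝒪^N`).
* [BruhatTits1972] F. Bruhat, J. Tits, *Groupes réductifs sur un corps local I*, Publ. Math. IHÉS 41 (1972), §10.
-/

set_option autoImplicit false

noncomputable section

namespace Summit.HodgeConjecture.HodgeConjecture.Cruxes.H413.F0P3cDyRamLattRowIdeal

open Matrix
open Literature.NumberTheory.Automorphic Literature.NumberTheory.Automorphic.HermitianLattice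
open Literature.NumberTheory.Automorphic.UnitaryLatticeTree
open scoped Valued WithZero Matrix MatrixGroups

variable {K : Type*} [Field K] [Valued K ℤᵐ⁰] {N : ℕ}

/-- **`|w_i| ≤ max_j |g_{ij}|` on `latt g`** (generic `N`): `w = g·u` with `|u_j| ≤ 1`, so `|w_i| = |Σ_j g_{ij}u_j| ≤ max_j |g_{ij}u_j| ≤ max_j |g_{ij}|` (ultrametric).
[cite: Serre1980Trees, II §1.1] -/
theorem v_apply_le_sup_of_mem_latt' [NeZero N] (g : Matrix (Fin N) (Fin N) K) (i : Fin N) {w : Fin N → K} (hw : w ∈ latt g) :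
    Valued.v (w i) ≤ Finset.univ.sup' Finset.univ_nonempty (fun j => Valued.v (g i j)) := by
  obtain ⟨u, hu, rfl⟩ := Submodule.mem_map.1 hw
  rw [LinearMap.restrictScalars_apply, Matrix.toLin'_apply, Matrix.mulVec, dotProduct]
  refine Valuation.map_sum_le _ fun j _ => ?_
  rw [map_mul]
  exact (mul_le_of_le_one_right' ((mem_stdLattice).1 hu j)).trans (Finset.le_sup' (fun j => Valued.v (g i j)) (Finset.mem_univ j))

/-- **The bound is attained** (generic `N`): at an argmax `j₀` of `j ↦ |g_{ij}|` the column `g·e_{j₀} ∈ latt g` has `i`-th coordinate `g_{ij₀}`. [cite: Serre1980Trees, II §1.1] -/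
theorem exists_mem_latt_v_apply_eq_sup' [NeZero N] (g : Matrix (Fin N) (Fin N) K) (i : Fin N) :
    ∃ w ∈ latt g, Valued.v (w i) = Finset.univ.sup' Finset.univ_nonempty (fun j => Valued.v (g i j)) := by
  obtain ⟨j₀, -, hj₀⟩ := Finset.exists_mem_eq_sup' (Finset.univ_nonempty (α := Fin N)) (fun j => Valued.v (g i j))
  refine ⟨g.mulVec (Pi.single j₀ 1), mulVec_single_mem_latt g j₀, ?_⟩
  rw [Matrix.mulVec_single_one, hj₀]
  rfl

/-- **«ROW IDEAL OF A COLUMN LATTICE», bound** (`N = 3`, brick verbatim): `w ∈ latt g ⇒ |w_i| ≤ max_j |g_{ij}|`. [cite: Serre1980Trees, II §1.1] [cite: BruhatTits1972, §10] -/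
theorem v_apply_le_sup_of_mem_latt {K : Type*} [Field K] [Valued K ℤᵐ⁰] (g : Matrix (Fin 3) (Fin 3) K) (i : Fin 3) {w : Fin 3 → K} (hw : w ∈ latt g) :
    Valued.v (w i) ≤ Finset.univ.sup' Finset.univ_nonempty (fun j => Valued.v (g i j)) :=
  v_apply_le_sup_of_mem_latt' g i hw

/-- **«ROW IDEAL OF A COLUMN LATTICE», attainment** (`N = 3`, brick verbatim): `∃ w ∈ latt g, |w_i| = max_j |g_{ij}|` — so the coordinate ideal `pr_i(latt g)` is `𝒪·(max_j |g_{ij}|)`.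
[cite: Serre1980Trees, II §1.1] [cite: BruhatTits1972, §10] -/
theorem exists_mem_latt_v_apply_eq_sup {K : Type*} [Field K] [Valued K ℤᵐ⁰] (g : Matrix (Fin 3) (Fin 3) K) (i : Fin 3) :
    ∃ w ∈ latt g, Valued.v (w i) = Finset.univ.sup' Finset.univ_nonempty (fun j => Valued.v (g i j)) :=
  exists_mem_latt_v_apply_eq_sup' g i

end Summit.HodgeConjecture.HodgeConjecture.Cruxes.H413.F0P3cDyRamLattRowIdeal

end
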